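import Literature.Computability.AlgebraicComplexity.AndrewsForbes2022Thm38Proofs

/-!
# Andrews–Forbes 2022, Corollary 3.10 — PROVED (`AndrewsForbes2022_cor_3_10_holds`)

Discharge of the named fact `AndrewsForbes2022_cor_3_10` of
`AndrewsForbes2022DeterminantalIdeals.lean` (val-lit row AndrewsForbes2022-A): for a nonzero
`f ∈ I^det_{n,m,r}`, an approximate oracle `h = f + O(ε)` and `w, d` with `w(d-1) + 2 ≤ r`, a
depth-three `h`-oracle circuit computes `IMM_{w,d}(y) + O(ε)` (characteristic zero),
[cite: AndrewsForbes2022, Cor. 3.10].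

This is the printed proof ("It is clear that `IMM_{w,d}` can be computed by a layered algebraic
branching program on `w(d-1)+2` vertices … Applying Theorem 3.8 completes the proof",
p0024:L88–L90), whose two ingredients are theorems of the tree:
`AndrewsForbes2022_cor_3_10_of_thm_3_8` (val-lit t24, the layered ABP for `IMM_{w,d}`,
`layeredABPComputes_imm11Poly`) and `AndrewsForbes2022_thm_3_8_holds` (val-lit t24,
`AndrewsForbes2022Thm38Proofs.lean`). Honest framing: a one-line composition closing a typed
literature fact (net debt −1); VP ≠ VNP is NOT proved and nothing here is progress on it.

## References
* [AndrewsForbes2022] R. Andrews, M. A. Forbes, STOC 2022, arXiv:2112.00792, Cor. 3.10 (proof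
  p. 24), Thm. 3.8.
-/

namespace Literature.Computability.AlgebraicComplexity

/-- **Andrews–Forbes 2022, Corollary 3.10 holds** (char `0`): discharge of the named fact
`AndrewsForbes2022_cor_3_10`, by Theorem 3.8 (`AndrewsForbes2022_thm_3_8_holds`) and the layered
ABP for `IMM_{w,d}` on `w(d-1)+2` vertices (`AndrewsForbes2022_cor_3_10_of_thm_3_8`).
[cite: AndrewsForbes2022, Cor. 3.10] -/
theorem AndrewsForbes2022_cor_3_10_holds : AndrewsForbes2022_cor_3_10 :=
  AndrewsForbes2022_cor_3_10_of_thm_3_8 AndrewsForbes2022_thm_3_8_holds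

end Literature.Computability.AlgebraicComplexity
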